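import Summits.CriticalPhenomena.Ising3D.Control2DRhoUpperEnvelope
import Summits.CriticalPhenomena.Ising3D.Control2DOpeDecay
import Mathlib.Analysis.SpecialFunctions.Pow.Real
import Mathlib.Analysis.SpecialFunctions.Log.Basic
import Mathlib.Tactic.Linarith
import Mathlib.Tactic.Positivity
import Mathlib.Tactic.FieldSimp
import Mathlib.Tactic.Ring
import Mathlib.Tactic.NormNum
import HarnessLib

/-!
# The sharp exponential rate `ρ(x₀)^E` of the `s`-channel expansion for every unitary solution of the typed 2D sum rule at `Δ_σ > 0`
(cell `pub-ising3x`, seat controls-1 gen 47; PAPER §6.2 / Appendix E — CONTROL-ONLY; sequel to `Control2DRhoUpperEnvelope`,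
`Control2DOpeDecay` (E.1x) and `Control2DAbelianTail` (E.1w))

HONEST FRAMING: lottery ticket; floor = tightest certified 3D Ising CFT bounds; no exact-solution
claim without a proof. CONTROL-ONLY (`d = 2`, global `sl(2) × sl(2)` blocks, `Δ_σ = s` an INPUT, axiom set `A2D′`);
nothing here is about `d = 3`, no certificate, functional or number of the record is touched, and no new hypothesis,
definition or named fact enters.

WHAT THIS FILE ADDS. E.1x (`Control2DOpeDecay.tail_le_radial`) reached the convergence-rate base `x₀/(4(1-x₀))` (`¼` at the crossing
point `x₀ = ½`) and left the sharp base `ρ(x₀)` (`3 - 2√2 ≈ 0.1716` at `½`) of Pappadopulo–Rychkov–Espin–Rattazzi §5.2 NOT reached.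
With the two-sided block estimate `2(4ρ)^Δ ≤ g_{Δ,ℓ}(z,z) ≤ 4e²(1+Δ)(4ρ)^Δ/(1-ρ)⁴` (`Control2DRhoCoordinate` + `Control2DRhoUpperEnvelope`,
no `ρ`-expansion) it is reached here, up to the polynomial prefactor:
* `summable_p_four_rpow_dim_mul_exp` — the Laplace family of the weights `w_i = p_i 4^{Δ_i} Δ_i` (`Δe^{-tΔ/2} ≤ 2/(et)`, inlined; a twin of
  that one-line inequality is landed in the tree's Balaban Literature and is not imported, to keep the closure inside `Control2D*`);
* `sum_p_four_rpow_dim_le` — their mass below `u` is `≤ B u^{4s+1}` (`u ≥ E ≥ 3s`), `B = ½e^{4s}16^s(5/(12s))^{4s}G(½,½)` (E.1x's density);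
* **`tail_le_rhoPow`** — for every unitary typed solution at `s > 0`, every `ρ₀ ∈ (0,1)` and every cut-off `E ≥ max(3s,1)` with
  `E·t > 4s+1`, `t = log(1/ρ₀)`: at `x₀ = 4ρ₀/(1+ρ₀)²`,
  `Σ'_{Δ_i ≥ E} p_i g_i(x₀,x₀) ≤ 8e²(1-ρ₀)^{-4} · B · E^{4s+1} · ρ₀^E · Et/(Et - 4s - 1)` — PRER's `|ρ(z)|^{Δ_*}` rate, which they show
  is best possible, with prefactor `E^{4s+1}` (theirs: `E^{4Δ_φ}`, stated as improvable); `tail_le_rhoPow_rhoZ`: the same at every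
  `x₀ ∈ (0,1)` with `ρ₀ = ρ(x₀) = (1-√(1-x₀))/(1+√(1-x₀))` written out; `tail_le_rhoPow_offDiag`: every `(z, z̄)` dominated by `(x₀,x₀)`;
* record rows at `Δ_σ = 1/8` (`G(½,½) ≤ 7/3` by gen-44 `record_fourPoint_half_le`): `record_tail_le_rhoPow` (`ρ₀`-parametrised, closed constant
  times `E^{3/2}ρ₀^E`) and **`record_tail_le_rhoPow_half`**: at the crossing point, for every `E ≥ 1`,
  `Σ'_{Δ_i ≥ E} p_i g_i(½,½) ≤ 8e²(10⁴/8284)⁴·(½e^{1/2}16^{1/8}(10/3)^{1/2}·7/3)·E^{3/2}·(1716/10⁴)^E·E log 5/(E log 5 - 3/2)` (base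
  `ρ(½) = 3 - 2√2 < 0.1716`; E.1n: `½`, E.1x: `¼`).

NOT claimed: the exact prefactor `E^{4Δ_φ}/Γ(4Δ_φ+1)` (the Tauberian EQUALITY in the `ρ`-frame needs positivity of the full `ρ`-series
of the blocks — the quadratic transformation, not proved); any LOWER bound on a tail; anything off the real diagonal beyond monotone
domination; complex `z` / the cut plane (where PRER's statement lives in full); `s = 0`; Virasoro; anything three-dimensional; any
bound on `Δ_ε`, `c` or `λ²`; nothing of the record touched, no new hypothesis or named fact. The paper is CONTEXT for what is proved,
not a cited input.

References: D. Pappadopulo, S. Rychkov, J. Espin, R. Rattazzi, Phys. Rev. D 86 (2012) 105043, §5.2 [cite: PappadopuloRychkovEspinRattazzi2012PRD, §5.2].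
Tree: `chiralBlock_le_sharp` (`Control2DRhoUpperEnvelope`); `two_mul_rpow_four_mul_le_globalBlock_diag` (`Control2DRhoCoordinate`); `sum_p_four_rpow_le_mul_rpow`, `summable_p_four_rpow_mul_exp`,
`summable_p_four_rpow_le_dim` (`Control2DOpeDecay`); `tsum_ge_mul_exp_le_of_le_rpow` (`Control2DAbelianTail`); `opeConvergent_free`
(`Control2DOpeConvergenceFree`); `four_mul_div_sq_mem_Ioo`, `four_mul_rhoZ_div_sq`, `rhoZ_mem_Ioo` (`Control2DRhoCoordinate`).
Mathlib: `Real.add_one_le_exp`, `Real.rpow_def_of_pos`, `Real.log_inv`, `Real.exp_one_lt_d9`, `Summable.of_nonneg_of_le`, `Summable.tsum_le_tsum`.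
-/

namespace Summit.CriticalPhenomena.Ising3D.Control2D

open Set Filter Topology
open Literature.MathematicalPhysics.QuantumFieldTheory.ConformalBootstrap3D

/-! ### The symmetrised global block on the diagonal (pure block analysis; here for the 400-line cap of its parent) -/

/-- **The symmetrised global block on the diagonal, upper half**: for a unitary label `ℓ ≤ Δ` and `ρ ∈ (0,1)`,
`g_{Δ,ℓ}(z,z) ≤ 4e²(1+Δ)(4ρ)^Δ/(1-ρ)⁴` at `z = 4ρ/(1+ρ)²` (`(1+√h)(1+√h̄) ≤ (1+√Δ)² ≤ 2(1+Δ)`, both weights `≤ Δ`). Together with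
`two_mul_rpow_four_mul_le_globalBlock_diag`: `2(4ρ)^Δ ≤ g_{Δ,ℓ}(z,z) ≤ 4e²(1+Δ)(4ρ)^Δ(1-ρ)^{-4}`. [folklore] -/
theorem globalBlock_diag_le_sharp {Δ : ℝ} {ℓ : ℕ} (hΔ : (ℓ : ℝ) ≤ Δ) {ρ : ℝ} (hρ : ρ ∈ Ioo (0 : ℝ) 1) :
    globalBlock Δ ℓ (4 * ρ / (1 + ρ) ^ 2) (4 * ρ / (1 + ρ) ^ 2) ≤
      4 * Real.exp 1 ^ 2 * (1 + Δ) * (4 * ρ) ^ Δ / (1 - ρ) ^ 4 := by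
  have hℓ : (0 : ℝ) ≤ ℓ := Nat.cast_nonneg ℓ
  have hh : 0 ≤ (Δ + ℓ) / 2 := by linarith
  have hhb : 0 ≤ (Δ - ℓ) / 2 := by linarith
  have hΔ0 : 0 ≤ Δ := by linarith
  have hz := four_mul_div_sq_mem_Ioo hρ
  have hQ : 0 < 1 - ρ := by linarith [hρ.2]
  have h4ρ : 0 < 4 * ρ := by linarith [hρ.1]
  have A := chiralBlock_le_sharp hh hρ
  have B := chiralBlock_le_sharp hhb hρ
  have hA0 : 0 ≤ chiralBlock ((Δ + ℓ) / 2) (4 * ρ / (1 + ρ) ^ 2) := chiralBlock_nonneg hh hz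
  have hB0 : 0 ≤ chiralBlock ((Δ - ℓ) / 2) (4 * ρ / (1 + ρ) ^ 2) := chiralBlock_nonneg hhb hz
  have hsplit : (4 * ρ) ^ ((Δ + ℓ) / 2) * (4 * ρ) ^ ((Δ - ℓ) / 2) = (4 * ρ) ^ Δ := by
    rw [← Real.rpow_add h4ρ]; ring_nf
  -- `√((Δ+ℓ)/2), √((Δ-ℓ)/2) ≤ √Δ` and `(1+√Δ)² ≤ 2(1+Δ)`
  have hs1 : Real.sqrt ((Δ + ℓ) / 2) ≤ Real.sqrt Δ := Real.sqrt_le_sqrt (by linarith)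
  have hs2 : Real.sqrt ((Δ - ℓ) / 2) ≤ Real.sqrt Δ := Real.sqrt_le_sqrt (by linarith)
  have hsΔ : Real.sqrt Δ ^ 2 = Δ := Real.sq_sqrt hΔ0
  have hsq : (1 + Real.sqrt ((Δ + ℓ) / 2)) * (1 + Real.sqrt ((Δ - ℓ) / 2)) ≤ 2 * (1 + Δ) := by
    have h1 : (1 + Real.sqrt ((Δ + ℓ) / 2)) * (1 + Real.sqrt ((Δ - ℓ) / 2)) ≤ (1 + Real.sqrt Δ) ^ 2 := by
      nlinarith [Real.sqrt_nonneg ((Δ + ℓ) / 2), Real.sqrt_nonneg ((Δ - ℓ) / 2), Real.sqrt_nonneg Δ]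
    nlinarith [sq_nonneg (Real.sqrt Δ - 1)]
  have he : 0 < Real.exp 1 := Real.exp_pos 1
  set X := Real.exp 1 * (1 + Real.sqrt ((Δ + ℓ) / 2)) * (4 * ρ) ^ ((Δ + ℓ) / 2) / (1 - ρ) ^ 2 with hX
  set Y := Real.exp 1 * (1 + Real.sqrt ((Δ - ℓ) / 2)) * (4 * ρ) ^ ((Δ - ℓ) / 2) / (1 - ρ) ^ 2 with hY
  have hprod : chiralBlock ((Δ + ℓ) / 2) (4 * ρ / (1 + ρ) ^ 2) * chiralBlock ((Δ - ℓ) / 2) (4 * ρ / (1 + ρ) ^ 2) ≤ X * Y :=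
    mul_le_mul A B hB0 (hA0.trans A)
  have hXY : X * Y = Real.exp 1 ^ 2 * ((1 + Real.sqrt ((Δ + ℓ) / 2)) * (1 + Real.sqrt ((Δ - ℓ) / 2))) *
      (4 * ρ) ^ Δ / (1 - ρ) ^ 4 := by
    rw [hX, hY, ← hsplit]; field_simp
  have hK : 0 ≤ Real.exp 1 ^ 2 * (4 * ρ) ^ Δ / (1 - ρ) ^ 4 := by positivity
  unfold globalBlock
  calc chiralBlock ((Δ + ℓ) / 2) (4 * ρ / (1 + ρ) ^ 2) * chiralBlock ((Δ - ℓ) / 2) (4 * ρ / (1 + ρ) ^ 2) +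
        chiralBlock ((Δ - ℓ) / 2) (4 * ρ / (1 + ρ) ^ 2) * chiralBlock ((Δ + ℓ) / 2) (4 * ρ / (1 + ρ) ^ 2)
      = 2 * (chiralBlock ((Δ + ℓ) / 2) (4 * ρ / (1 + ρ) ^ 2) * chiralBlock ((Δ - ℓ) / 2) (4 * ρ / (1 + ρ) ^ 2)) := by ring
    _ ≤ 2 * (X * Y) := by nlinarith [hprod]
    _ = 2 * ((1 + Real.sqrt ((Δ + ℓ) / 2)) * (1 + Real.sqrt ((Δ - ℓ) / 2))) * (Real.exp 1 ^ 2 * (4 * ρ) ^ Δ / (1 - ρ) ^ 4) := by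
        rw [hXY]; ring
    _ ≤ 2 * (2 * (1 + Δ)) * (Real.exp 1 ^ 2 * (4 * ρ) ^ Δ / (1 - ρ) ^ 4) :=
        mul_le_mul_of_nonneg_right (mul_le_mul_of_nonneg_left hsq (by norm_num)) hK
    _ = _ := by ring

namespace CrossingData

variable {D : CrossingData} {s : ℝ}

/-- **The Laplace family of the weights `w_i = p_i 4^{Δ_i} Δ_i`** is summable for every `t > 0` (unitary data with convergent expansion):
`Δ_i e^{-tΔ_i} ≤ (2/(et)) e^{-tΔ_i/2}` and E.1x's `summable_p_four_rpow_mul_exp` at `t/2`. [folklore] -/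
theorem summable_p_four_rpow_dim_mul_exp (hU : D.IsUnitary) (hconv : D.OpeConvergent) {t : ℝ} (ht : 0 < t) :
    Summable fun i => D.p i * (4 : ℝ) ^ D.Δ i * D.Δ i * Real.exp (-(t * D.Δ i)) := by
  have ht2 : 0 < t / 2 := by linarith
  have S := (summable_p_four_rpow_mul_exp hU hconv ht2).mul_left (1 / (Real.exp 1 * (t / 2)))
  refine S.of_nonneg_of_le (fun i => ?_) fun i => ?_
  · have hΔ : 0 ≤ D.Δ i := (Nat.cast_nonneg _).trans (hU i).2.1
    exact mul_nonneg (mul_nonneg (mul_nonneg (hU i).2.2 (Real.rpow_nonneg (by norm_num) _)) hΔ) (Real.exp_pos _).le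
  · have hw : 0 ≤ D.p i * (4 : ℝ) ^ D.Δ i := mul_nonneg (hU i).2.2 (Real.rpow_nonneg (by norm_num) _)
    -- `x e^{-ax} ≤ 1/(ea)` at `a = t/2` (`1 + y ≤ e^y` at `y = ax - 1`; a twin is landed in the tree's Balaban Literature — inlined
    -- here to keep the control's closure inside `Control2D*` + Mathlib)
    have hkey : D.Δ i * Real.exp (-(t / 2 * D.Δ i)) ≤ 1 / (Real.exp 1 * (t / 2)) := by
      have h1 : t / 2 * D.Δ i - 1 + 1 ≤ Real.exp (t / 2 * D.Δ i - 1) := Real.add_one_le_exp _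
      rw [Real.exp_sub] at h1
      have he : 0 < Real.exp 1 := Real.exp_pos 1
      have hax : 0 < Real.exp (t / 2 * D.Δ i) := Real.exp_pos _
      rw [le_div_iff₀ he] at h1
      rw [Real.exp_neg, le_div_iff₀ (mul_pos he ht2)]
      have : D.Δ i * (Real.exp (t / 2 * D.Δ i))⁻¹ * (Real.exp 1 * (t / 2)) =
          t / 2 * D.Δ i * Real.exp 1 / Real.exp (t / 2 * D.Δ i) := by field_simp
      rw [this, div_le_one hax]
      linarith
    have hsplit : Real.exp (-(t * D.Δ i)) = Real.exp (-(t / 2 * D.Δ i)) * Real.exp (-(t / 2 * D.Δ i)) := by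
      rw [← Real.exp_add]; ring_nf
    rw [hsplit]
    calc D.p i * (4 : ℝ) ^ D.Δ i * D.Δ i * (Real.exp (-(t / 2 * D.Δ i)) * Real.exp (-(t / 2 * D.Δ i)))
        = D.p i * (4 : ℝ) ^ D.Δ i * Real.exp (-(t / 2 * D.Δ i)) * (D.Δ i * Real.exp (-(t / 2 * D.Δ i))) := by ring
      _ ≤ D.p i * (4 : ℝ) ^ D.Δ i * Real.exp (-(t / 2 * D.Δ i)) * (1 / (Real.exp 1 * (t / 2))) :=
          mul_le_mul_of_nonneg_left hkey (mul_nonneg hw (Real.exp_pos _).le)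
      _ = _ := by ring

/-- **Mass of the weights `p_i 4^{Δ_i} Δ_i` below `u`**: for every unitary typed solution at `s > 0` and `u ≥ E ≥ 3s`,
`Σ'_{Δ_i ≤ u} p_i 4^{Δ_i} Δ_i ≤ B · u^{4s+1}` with `B = ½e^{4s}16^s(5/(12s))^{4s}G(½,½)` (E.1x's `sum_p_four_rpow_le_mul_rpow` and `Δ_i ≤ u`).
[cite: PappadopuloRychkovEspinRattazzi2012PRD, §5.2] -/
theorem sum_p_four_rpow_dim_le (hU : D.IsUnitary) (hC : D.SatisfiesCrossing s) (hs : 0 < s) {E u : ℝ} (hE : 3 * s ≤ E)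
    (hu : E ≤ u) :
    ∑' i : ↥({i : D.ι | D.Δ i ≤ u} : Set D.ι), D.p i * (4 : ℝ) ^ D.Δ (i : D.ι) * D.Δ (i : D.ι) ≤
      1 / 2 * Real.exp (4 * s) * (16 : ℝ) ^ s * (5 / (12 * s)) ^ (4 * s) * D.fourPoint (1 / 2) (1 / 2) * u ^ (4 * s + 1) := by
  have hconv := opeConvergent_free hU hC hs
  have hu0 : 0 < u := by linarith
  set T : Set D.ι := {i : D.ι | D.Δ i ≤ u} with hT
  have hS := summable_p_four_rpow_le_dim hU hconv u
  have hle : ∀ i : ↥T, D.p i * (4 : ℝ) ^ D.Δ (i : D.ι) * D.Δ (i : D.ι) ≤ u * (D.p i * (4 : ℝ) ^ D.Δ (i : D.ι)) := by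
    intro i
    have hi : D.Δ (i : D.ι) ≤ u := i.2
    have hw : 0 ≤ D.p i * (4 : ℝ) ^ D.Δ (i : D.ι) := mul_nonneg (hU i).2.2 (Real.rpow_nonneg (by norm_num) _)
    nlinarith
  have hS' : Summable fun i : ↥T => D.p i * (4 : ℝ) ^ D.Δ (i : D.ι) * D.Δ (i : D.ι) :=
    (hS.mul_left u).of_nonneg_of_le
      (fun i => mul_nonneg (mul_nonneg (hU i).2.2 (Real.rpow_nonneg (by norm_num) _)) ((Nat.cast_nonneg _).trans (hU i).2.1)) hle
  have h1 : ∑' i : ↥T, D.p i * (4 : ℝ) ^ D.Δ (i : D.ι) * D.Δ (i : D.ι) ≤ u * ∑' i : ↥T, D.p i * (4 : ℝ) ^ D.Δ (i : D.ι) := by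
    rw [← tsum_mul_left]; exact hS'.tsum_le_tsum hle (hS.mul_left u)
  have h2 := sum_p_four_rpow_le_mul_rpow hU hC hs hE hu
  have hpow : u * u ^ (4 * s) = u ^ (4 * s + 1) := by rw [Real.rpow_add_one hu0.ne']; ring
  calc ∑' i : ↥T, D.p i * (4 : ℝ) ^ D.Δ (i : D.ι) * D.Δ (i : D.ι)
      ≤ u * (1 / 2 * Real.exp (4 * s) * (16 : ℝ) ^ s * (5 / (12 * s)) ^ (4 * s) * D.fourPoint (1 / 2) (1 / 2) * u ^ (4 * s)) :=
        h1.trans (mul_le_mul_of_nonneg_left h2 hu0.le)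
    _ = _ := by rw [← hpow]; ring

/-- **The sharp exponential rate** (after Pappadopulo–Rychkov–Espin–Rattazzi 2012 §5.2, for the typed class, with no `ρ`-expansion): for
every unitary solution of the typed sum rule at `Δ_σ = s > 0`, every `ρ₀ ∈ (0,1)` and every cut-off `E ≥ max(3s, 1)` with
`E·t > 4s+1` where `t = log(1/ρ₀) > 0`, at the diagonal point `x₀ = 4ρ₀/(1+ρ₀)²` (every `x₀ ∈ (0,1)` is of this form, `ρ₀ = ρ(x₀)`):
`Σ'_{Δ_i ≥ E} p_i g_i(x₀,x₀) ≤ 8e²/(1-ρ₀)⁴ · [½e^{4s}16^s(5/(12s))^{4s}G(½,½)] · E^{4s+1} · ρ₀^E · Et/(Et - 4s - 1)` — termwise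
`p_i g_i ≤ 8e²(1-ρ₀)^{-4}·(p_i4^{Δ_i}Δ_i)·ρ₀^{Δ_i}` (`globalBlock_diag_le_sharp`, `1+Δ ≤ 2Δ`), then E.1w's Abelian lemma with exponent
`4s+1`. The base `ρ₀ = ρ(x₀)` is `3 - 2√2 ≈ 0.1716` at `x₀ = ½` (E.1n: `½`; E.1x: `¼`). [cite: PappadopuloRychkovEspinRattazzi2012PRD, §5.2] -/
theorem tail_le_rhoPow (hU : D.IsUnitary) (hC : D.SatisfiesCrossing s) (hs : 0 < s) {ρ₀ E : ℝ} (hρ₀ : ρ₀ ∈ Ioo (0 : ℝ) 1)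
    (hE : 3 * s ≤ E) (hE1 : 1 ≤ E) (hEt : 4 * s + 1 < E * Real.log (1 / ρ₀)) :
    ∑' i : ↥({i : D.ι | E ≤ D.Δ i} : Set D.ι),
        D.p i * globalBlock (D.Δ i) (D.spin i) (4 * ρ₀ / (1 + ρ₀) ^ 2) (4 * ρ₀ / (1 + ρ₀) ^ 2) ≤
      8 * Real.exp 1 ^ 2 / (1 - ρ₀) ^ 4 *
        (1 / 2 * Real.exp (4 * s) * (16 : ℝ) ^ s * (5 / (12 * s)) ^ (4 * s) * D.fourPoint (1 / 2) (1 / 2)) *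
        E ^ (4 * s + 1) * ρ₀ ^ E *
        (E * Real.log (1 / ρ₀) / (E * Real.log (1 / ρ₀) - (4 * s + 1))) := by
  have hconv := opeConvergent_free hU hC hs
  have hz := four_mul_div_sq_mem_Ioo hρ₀
  have hE0 : 0 < E := by linarith
  have hQ : 0 < 1 - ρ₀ := by linarith [hρ₀.2]
  set x₀ : ℝ := 4 * ρ₀ / (1 + ρ₀) ^ 2 with hx₀
  set t : ℝ := Real.log (1 / ρ₀) with htdef
  set T : Set D.ι := {i : D.ι | E ≤ D.Δ i} with hT
  set K : ℝ := 8 * Real.exp 1 ^ 2 / (1 - ρ₀) ^ 4 with hK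
  have hK0 : 0 ≤ K := by positivity
  have ht : 0 < t := Real.log_pos (by rw [lt_div_iff₀ hρ₀.1]; linarith [hρ₀.2])
  have hexp : ∀ y : ℝ, Real.exp (-(t * y)) = ρ₀ ^ y := by
    intro y
    rw [Real.rpow_def_of_pos hρ₀.1, htdef, one_div, Real.log_inv]; ring_nf
  -- E.1w's Abelian lemma on `w_i = p_i 4^{Δ_i} Δ_i`, exponent `4s+1`
  have hw : ∀ i, 0 ≤ D.p i * (4 : ℝ) ^ D.Δ i * D.Δ i := fun i =>
    mul_nonneg (mul_nonneg (hU i).2.2 (Real.rpow_nonneg (by norm_num) _)) ((Nat.cast_nonneg _).trans (hU i).2.1)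
  have hAbel := tsum_ge_mul_exp_le_of_le_rpow (w := fun i => D.p i * (4 : ℝ) ^ D.Δ i * D.Δ i) (E := D.Δ) hw
    (fun t ht => summable_p_four_rpow_dim_mul_exp hU hconv ht)
    (B := 1 / 2 * Real.exp (4 * s) * (16 : ℝ) ^ s * (5 / (12 * s)) ^ (4 * s) * D.fourPoint (1 / 2) (1 / 2))
    (ρ := 4 * s + 1) (T := E) (t := t) (by linarith) hE0 ht (by linarith) (fun u hu => sum_p_four_rpow_dim_le hU hC hs hE hu)
  -- termwise: `p_i g_i(x₀,x₀) ≤ K · w_i · e^{-tΔ_i}` on `T`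
  have hWT : Summable fun i : ↥T => D.p i * (4 : ℝ) ^ D.Δ (i : D.ι) * D.Δ (i : D.ι) * Real.exp (-(t * D.Δ (i : D.ι))) :=
    (summable_p_four_rpow_dim_mul_exp hU hconv ht).subtype T
  have hle : ∀ i : ↥T, D.p i * globalBlock (D.Δ (i : D.ι)) (D.spin (i : D.ι)) x₀ x₀ ≤
      K * (D.p i * (4 : ℝ) ^ D.Δ (i : D.ι) * D.Δ (i : D.ι) * Real.exp (-(t * D.Δ (i : D.ι)))) := by
    intro i
    have hi : E ≤ D.Δ (i : D.ι) := i.2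
    have hΔ1 : 1 ≤ D.Δ (i : D.ι) := hE1.trans hi
    have hg := globalBlock_diag_le_sharp (hU i).2.1 hρ₀
    have hp0 : 0 ≤ D.p i := (hU i).2.2
    have h4ρ : (4 * ρ₀) ^ D.Δ (i : D.ι) = (4 : ℝ) ^ D.Δ (i : D.ι) * ρ₀ ^ D.Δ (i : D.ι) := Real.mul_rpow (by norm_num) hρ₀.1.le
    rw [hexp, hK]
    rw [h4ρ] at hg
    have hA : 0 ≤ (4 : ℝ) ^ D.Δ (i : D.ι) * ρ₀ ^ D.Δ (i : D.ι) / (1 - ρ₀) ^ 4 :=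
      div_nonneg (mul_nonneg (Real.rpow_nonneg (by norm_num) _) (Real.rpow_nonneg hρ₀.1.le _)) (pow_nonneg hQ.le 4)
    have h1Δ : 1 + D.Δ (i : D.ι) ≤ 2 * D.Δ (i : D.ι) := by linarith
    calc D.p i * globalBlock (D.Δ (i : D.ι)) (D.spin (i : D.ι)) x₀ x₀
        ≤ D.p i * (4 * Real.exp 1 ^ 2 * (1 + D.Δ (i : D.ι)) * ((4 : ℝ) ^ D.Δ (i : D.ι) * ρ₀ ^ D.Δ (i : D.ι)) / (1 - ρ₀) ^ 4) :=
          mul_le_mul_of_nonneg_left hg hp0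
      _ = D.p i * (4 * Real.exp 1 ^ 2) * (1 + D.Δ (i : D.ι)) * ((4 : ℝ) ^ D.Δ (i : D.ι) * ρ₀ ^ D.Δ (i : D.ι) / (1 - ρ₀) ^ 4) := by
          ring
      _ ≤ D.p i * (4 * Real.exp 1 ^ 2) * (2 * D.Δ (i : D.ι)) * ((4 : ℝ) ^ D.Δ (i : D.ι) * ρ₀ ^ D.Δ (i : D.ι) / (1 - ρ₀) ^ 4) :=
          mul_le_mul_of_nonneg_right (mul_le_mul_of_nonneg_left h1Δ (mul_nonneg hp0 (by positivity))) hA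
      _ = _ := by field_simp; ring
  have hGT : Summable fun i : ↥T => D.p i * globalBlock (D.Δ (i : D.ι)) (D.spin (i : D.ι)) x₀ x₀ :=
    (hconv x₀ x₀ hz hz).subtype T
  have h1 : ∑' i : ↥T, D.p i * globalBlock (D.Δ (i : D.ι)) (D.spin (i : D.ι)) x₀ x₀ ≤
      K * ∑' i : ↥T, D.p i * (4 : ℝ) ^ D.Δ (i : D.ι) * D.Δ (i : D.ι) * Real.exp (-(t * D.Δ (i : D.ι))) := by
    rw [← tsum_mul_left]; exact hGT.tsum_le_tsum hle (hWT.mul_left K)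
  have hmain := h1.trans (mul_le_mul_of_nonneg_left hAbel hK0)
  rw [hexp E] at hmain
  refine hmain.trans (le_of_eq ?_)
  ring

/-- **The sharp rate at every diagonal point `x₀ ∈ (0,1)`**, with PRER's `ρ₀ = ρ(x₀) = (1-√(1-x₀))/(1+√(1-x₀))` written out (`4ρ₀/(1+ρ₀)² = x₀`,
`Control2DRhoCoordinate.four_mul_rhoZ_div_sq`). [cite: PappadopuloRychkovEspinRattazzi2012PRD, §5.2] -/
theorem tail_le_rhoPow_rhoZ (hU : D.IsUnitary) (hC : D.SatisfiesCrossing s) (hs : 0 < s) {x₀ E : ℝ} (hx₀ : x₀ ∈ Ioo (0 : ℝ) 1)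
    (hE : 3 * s ≤ E) (hE1 : 1 ≤ E)
    (hEt : 4 * s + 1 < E * Real.log (1 / ((1 - Real.sqrt (1 - x₀)) / (1 + Real.sqrt (1 - x₀))))) :
    ∑' i : ↥({i : D.ι | E ≤ D.Δ i} : Set D.ι), D.p i * globalBlock (D.Δ i) (D.spin i) x₀ x₀ ≤
      8 * Real.exp 1 ^ 2 / (1 - (1 - Real.sqrt (1 - x₀)) / (1 + Real.sqrt (1 - x₀))) ^ 4 *
        (1 / 2 * Real.exp (4 * s) * (16 : ℝ) ^ s * (5 / (12 * s)) ^ (4 * s) * D.fourPoint (1 / 2) (1 / 2)) *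
        E ^ (4 * s + 1) * ((1 - Real.sqrt (1 - x₀)) / (1 + Real.sqrt (1 - x₀))) ^ E *
        (E * Real.log (1 / ((1 - Real.sqrt (1 - x₀)) / (1 + Real.sqrt (1 - x₀)))) /
          (E * Real.log (1 / ((1 - Real.sqrt (1 - x₀)) / (1 + Real.sqrt (1 - x₀)))) - (4 * s + 1))) := by
  have h := tail_le_rhoPow hU hC hs (rhoZ_mem_Ioo hx₀) hE hE1 hEt
  rwa [four_mul_rhoZ_div_sq hx₀] at h

/-- **Off the diagonal**: for `0 < z, z̄ ≤ x₀` (`x₀ ∈ (0,1)`) the tail at `(z,z̄)` is at most the tail at `(x₀,x₀)` (`globalBlock_mono`), so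
the sharp rate `ρ(x₀)^E` holds at every point of the square dominated by `(x₀,x₀)`. [cite: PappadopuloRychkovEspinRattazzi2012PRD, §5.2] -/
theorem tail_le_rhoPow_offDiag (hU : D.IsUnitary) (hC : D.SatisfiesCrossing s) (hs : 0 < s) {z zb x₀ E : ℝ} (hz : 0 < z)
    (hzb : 0 < zb) (hzx : z ≤ x₀) (hzbx : zb ≤ x₀) (hx₀1 : x₀ < 1) (hE : 3 * s ≤ E) (hE1 : 1 ≤ E)
    (hEt : 4 * s + 1 < E * Real.log (1 / ((1 - Real.sqrt (1 - x₀)) / (1 + Real.sqrt (1 - x₀))))) :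
    ∑' i : ↥({i : D.ι | E ≤ D.Δ i} : Set D.ι), D.p i * globalBlock (D.Δ i) (D.spin i) z zb ≤
      8 * Real.exp 1 ^ 2 / (1 - (1 - Real.sqrt (1 - x₀)) / (1 + Real.sqrt (1 - x₀))) ^ 4 *
        (1 / 2 * Real.exp (4 * s) * (16 : ℝ) ^ s * (5 / (12 * s)) ^ (4 * s) * D.fourPoint (1 / 2) (1 / 2)) *
        E ^ (4 * s + 1) * ((1 - Real.sqrt (1 - x₀)) / (1 + Real.sqrt (1 - x₀))) ^ E *
        (E * Real.log (1 / ((1 - Real.sqrt (1 - x₀)) / (1 + Real.sqrt (1 - x₀)))) /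
          (E * Real.log (1 / ((1 - Real.sqrt (1 - x₀)) / (1 + Real.sqrt (1 - x₀)))) - (4 * s + 1))) := by
  have hconv := opeConvergent_free hU hC hs
  have hx₀ : 0 < x₀ := lt_of_lt_of_le hz hzx
  have hzI : z ∈ Ioo (0 : ℝ) 1 := ⟨hz, lt_of_le_of_lt hzx hx₀1⟩
  have hzbI : zb ∈ Ioo (0 : ℝ) 1 := ⟨hzb, lt_of_le_of_lt hzbx hx₀1⟩
  set T : Set D.ι := {i : D.ι | E ≤ D.Δ i} with hT
  have h1 : ∑' i : ↥T, D.p i * globalBlock (D.Δ i) (D.spin i) z zb ≤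
      ∑' i : ↥T, D.p i * globalBlock (D.Δ i) (D.spin i) x₀ x₀ :=
    ((hconv z zb hzI hzbI).subtype T).tsum_le_tsum
      (fun i => mul_le_mul_of_nonneg_left (globalBlock_mono (hU i).2.1 hz hzb hzx hzbx hx₀1 hx₀1) (hU i).2.2)
      ((hconv x₀ x₀ ⟨hx₀, hx₀1⟩ ⟨hx₀, hx₀1⟩).subtype T)
  exact h1.trans (tail_le_rhoPow_rhoZ hU hC hs ⟨hx₀, hx₀1⟩ hE hE1 hEt)

end CrossingData

/-! ### The record's class at `Δ_σ = 1/8` -/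

/-- `e^{3/2} < 5`, hence `log 5 > 3/2` (`e < 2.7182818286`, `(e^{1/2})² = e`). [folklore] -/
theorem three_halves_lt_log_five : (3 / 2 : ℝ) < Real.log 5 := by
  rw [Real.lt_log_iff_exp_lt (by norm_num : (0 : ℝ) < 5)]
  have h1 : Real.exp 1 < 2.7182818286 := Real.exp_one_lt_d9
  have hsq : Real.exp (1 / 2) * Real.exp (1 / 2) = Real.exp 1 := by rw [← Real.exp_add]; norm_num
  have hpos : 0 < Real.exp (1 / 2) := Real.exp_pos _
  have h2 : Real.exp (1 / 2) < 33 / 20 := by nlinarith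
  rw [show (3 / 2 : ℝ) = 1 + 1 / 2 by norm_num, Real.exp_add]
  nlinarith [Real.exp_pos 1]

/-- **The sharp rate for every datum of the record's class at `Δ_σ = 1/8`** (binders of E.1n's `record_sum_p_low_le`; `G(½,½) ≤ 7/3` by
gen-44 `record_fourPoint_half_le`), `ρ₀`-parametrised: for every `ρ₀ ∈ (0,1)` and `E ≥ 1` with `E·log(1/ρ₀) > 3/2`, at `x₀ = 4ρ₀/(1+ρ₀)²`,
`Σ'_{Δ_i ≥ E} p_i g_i(x₀,x₀) ≤ 8e²/(1-ρ₀)⁴ · (½e^{1/2}16^{1/8}(10/3)^{1/2}·7/3) · E^{3/2} · ρ₀^E · Et/(Et - 3/2)`, `t = log(1/ρ₀)` — a CLOSED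
constant times `E^{3/2} ρ₀^E`. CONTROL-ONLY; no certificate or number of the record is touched. [folklore] -/
theorem record_tail_le_rhoPow (w : ℝ) (D : CrossingData) (hU : D.IsUnitary) (hC : D.SatisfiesCrossing (1 / 8))
    (hT : D.SpinTwoIn ({2} ∪ Ici (2 + 1))) (x : ℝ) (hwx : w ≤ x) (hS : D.ScalarsIn ({x} ∪ Ici 2)) {ρ₀ E : ℝ}
    (hρ₀ : ρ₀ ∈ Ioo (0 : ℝ) 1) (hE : 1 ≤ E) (hEt : 3 / 2 < E * Real.log (1 / ρ₀)) :
    ∑' i : ↥({i : D.ι | E ≤ D.Δ i} : Set D.ι),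
        D.p i * globalBlock (D.Δ i) (D.spin i) (4 * ρ₀ / (1 + ρ₀) ^ 2) (4 * ρ₀ / (1 + ρ₀) ^ 2) ≤
      8 * Real.exp 1 ^ 2 / (1 - ρ₀) ^ 4 *
        (1 / 2 * Real.exp (1 / 2) * (16 : ℝ) ^ (1 / 8 : ℝ) * (10 / 3 : ℝ) ^ (1 / 2 : ℝ) * (7 / 3)) *
        E ^ (3 / 2 : ℝ) * ρ₀ ^ E * (E * Real.log (1 / ρ₀) / (E * Real.log (1 / ρ₀) - 3 / 2)) := by
  have h := CrossingData.tail_le_rhoPow hU hC (s := 1 / 8) (by norm_num) hρ₀ (E := E) (by linarith) hE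
    (by rw [show 4 * (1 / 8 : ℝ) + 1 = 3 / 2 by norm_num]; exact hEt)
  have hG := record_fourPoint_half_le w D hU hC hT x hwx hS
  rw [show (4 * (1 / 8 : ℝ)) = 1 / 2 by norm_num, show (5 / (12 * (1 / 8 : ℝ))) = 10 / 3 by norm_num,
    show (1 / 2 : ℝ) + 1 = 3 / 2 by norm_num] at h
  have hQ : 0 < 1 - ρ₀ := by linarith [hρ₀.2]
  have ht : 0 < Real.log (1 / ρ₀) := Real.log_pos (by rw [lt_div_iff₀ hρ₀.1]; linarith [hρ₀.2])
  have hL : 0 ≤ E * Real.log (1 / ρ₀) / (E * Real.log (1 / ρ₀) - 3 / 2) := div_nonneg (by positivity) (by linarith)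
  have hR : 0 ≤ E ^ (3 / 2 : ℝ) * ρ₀ ^ E * (E * Real.log (1 / ρ₀) / (E * Real.log (1 / ρ₀) - 3 / 2)) :=
    mul_nonneg (mul_nonneg (Real.rpow_nonneg (by linarith) _) (Real.rpow_nonneg hρ₀.1.le _)) hL
  have hKpos : 0 ≤ 8 * Real.exp 1 ^ 2 / (1 - ρ₀) ^ 4 * (1 / 2 * Real.exp (1 / 2) * (16 : ℝ) ^ (1 / 8 : ℝ) * (10 / 3 : ℝ) ^ (1 / 2 : ℝ)) := by
    positivity
  calc ∑' i : ↥({i : D.ι | E ≤ D.Δ i} : Set D.ι),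
        D.p i * globalBlock (D.Δ i) (D.spin i) (4 * ρ₀ / (1 + ρ₀) ^ 2) (4 * ρ₀ / (1 + ρ₀) ^ 2)
      ≤ 8 * Real.exp 1 ^ 2 / (1 - ρ₀) ^ 4 *
          (1 / 2 * Real.exp (1 / 2) * (16 : ℝ) ^ (1 / 8 : ℝ) * (10 / 3 : ℝ) ^ (1 / 2 : ℝ) * D.fourPoint (1 / 2) (1 / 2)) *
          E ^ (3 / 2 : ℝ) * ρ₀ ^ E * (E * Real.log (1 / ρ₀) / (E * Real.log (1 / ρ₀) - 3 / 2)) := h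
    _ = 8 * Real.exp 1 ^ 2 / (1 - ρ₀) ^ 4 * (1 / 2 * Real.exp (1 / 2) * (16 : ℝ) ^ (1 / 8 : ℝ) * (10 / 3 : ℝ) ^ (1 / 2 : ℝ)) *
          D.fourPoint (1 / 2) (1 / 2) * (E ^ (3 / 2 : ℝ) * ρ₀ ^ E * (E * Real.log (1 / ρ₀) / (E * Real.log (1 / ρ₀) - 3 / 2))) := by
        ring
    _ ≤ 8 * Real.exp 1 ^ 2 / (1 - ρ₀) ^ 4 * (1 / 2 * Real.exp (1 / 2) * (16 : ℝ) ^ (1 / 8 : ℝ) * (10 / 3 : ℝ) ^ (1 / 2 : ℝ)) *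
          (7 / 3) * (E ^ (3 / 2 : ℝ) * ρ₀ ^ E * (E * Real.log (1 / ρ₀) / (E * Real.log (1 / ρ₀) - 3 / 2))) :=
        mul_le_mul_of_nonneg_right (mul_le_mul_of_nonneg_left hG hKpos) hR
    _ = _ := by ring

/-- **The sharp rate at the crossing point `x₀ = ½` for every datum of the record's class at `Δ_σ = 1/8`**, with a printed base:
`ρ(½) = (1-√½)/(1+√½) = 3 - 2√2 < 1716/10⁴` (`Control2DRhoCoordinate.rhoZ_half_lt`), so `ρ(½)^E ≤ (1716/10⁴)^E`, `(1-ρ(½))^{-4} ≤ (10⁴/8284)⁴`,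
and the side condition is automatic for `E ≥ 1` — the arithmetic line: at `s = 1/8`, `4s + 1 = 3/2`, and `ρ(½) < 1716/10⁴ < 1/5` gives
`t = log(1/ρ(½)) ≥ log 5 > 3/2` (`e^{3/2} < 2.7183·1.65 < 5`, `three_halves_lt_log_five`), so `E·t ≥ t > 3/2 = 4s + 1` for every `E ≥ 1`, and
`Et/(Et-3/2)` decreases in `t`, whence `≤ E log 5/(E log 5 - 3/2)`: for every `E ≥ 1`,
`Σ'_{Δ_i ≥ E} p_i g_i(½,½) ≤ 8e²(10⁴/8284)⁴ · (½e^{1/2}16^{1/8}(10/3)^{1/2}·7/3) · E^{3/2} · (1716/10⁴)^E · E·log 5/(E·log 5 - 3/2)` —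
against E.1n's `(7/3)e^{1/4}(4E)^{1/4}·(½)^E` and E.1x's base `¼`. CONTROL-ONLY; no certificate or number of the record is touched. [folklore] -/
theorem record_tail_le_rhoPow_half (w : ℝ) (D : CrossingData) (hU : D.IsUnitary) (hC : D.SatisfiesCrossing (1 / 8))
    (hT : D.SpinTwoIn ({2} ∪ Ici (2 + 1))) (x : ℝ) (hwx : w ≤ x) (hS : D.ScalarsIn ({x} ∪ Ici 2)) {E : ℝ} (hE : 1 ≤ E) :
    ∑' i : ↥({i : D.ι | E ≤ D.Δ i} : Set D.ι), D.p i * globalBlock (D.Δ i) (D.spin i) (1 / 2) (1 / 2) ≤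
      8 * Real.exp 1 ^ 2 * ((10000 : ℝ) / 8284) ^ 4 *
        (1 / 2 * Real.exp (1 / 2) * (16 : ℝ) ^ (1 / 8 : ℝ) * (10 / 3 : ℝ) ^ (1 / 2 : ℝ) * (7 / 3)) *
        E ^ (3 / 2 : ℝ) * ((1716 : ℝ) / 10000) ^ E * (E * Real.log 5 / (E * Real.log 5 - 3 / 2)) := by
  have hhalf : (1 / 2 : ℝ) ∈ Ioo (0 : ℝ) 1 := ⟨by norm_num, by norm_num⟩
  set ρ₀ : ℝ := (1 - Real.sqrt (1 - 1 / 2)) / (1 + Real.sqrt (1 - 1 / 2)) with hρ₀def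
  have hρ₀ : ρ₀ ∈ Ioo (0 : ℝ) 1 := rhoZ_mem_Ioo hhalf
  have hρ₀lt : ρ₀ < 1716 / 10000 := rhoZ_half_lt
  have hz : 4 * ρ₀ / (1 + ρ₀) ^ 2 = 1 / 2 := four_mul_rhoZ_div_sq hhalf
  have hlog5 := three_halves_lt_log_five
  -- `t = log(1/ρ₀) ≥ log 5 > 3/2`
  have hinv : (5 : ℝ) ≤ 1 / ρ₀ := by rw [le_div_iff₀ hρ₀.1]; linarith
  have ht5 : Real.log 5 ≤ Real.log (1 / ρ₀) := Real.log_le_log (by norm_num) hinv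
  have hE0 : 0 < E := by linarith
  have hEt5 : 3 / 2 < E * Real.log 5 := by nlinarith
  have hEt : 3 / 2 < E * Real.log (1 / ρ₀) := by nlinarith
  have h := record_tail_le_rhoPow w D hU hC hT x hwx hS hρ₀ hE hEt
  rw [hz] at h
  -- bound the four `ρ₀`-dependent factors by their printed values
  set B : ℝ := 1 / 2 * Real.exp (1 / 2) * (16 : ℝ) ^ (1 / 8 : ℝ) * (10 / 3 : ℝ) ^ (1 / 2 : ℝ) * (7 / 3) with hB
  have hB0 : 0 ≤ B := by positivity
  have hQ : 0 < 1 - ρ₀ := by linarith [hρ₀.2]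
  have h1 : 8 * Real.exp 1 ^ 2 / (1 - ρ₀) ^ 4 ≤ 8 * Real.exp 1 ^ 2 * ((10000 : ℝ) / 8284) ^ 4 := by
    rw [div_eq_mul_inv, ← inv_pow, show ((10000 : ℝ) / 8284) = (8284 / 10000)⁻¹ by norm_num]
    refine mul_le_mul_of_nonneg_left (pow_le_pow_left₀ (by positivity) ?_ 4) (by positivity)
    exact inv_anti₀ (by norm_num) (by linarith)
  have h2 : ρ₀ ^ E ≤ ((1716 : ℝ) / 10000) ^ E := Real.rpow_le_rpow hρ₀.1.le hρ₀lt.le hE0.le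
  have h3 : E * Real.log (1 / ρ₀) / (E * Real.log (1 / ρ₀) - 3 / 2) ≤ E * Real.log 5 / (E * Real.log 5 - 3 / 2) := by
    rw [div_le_div_iff₀ (by linarith) (by linarith)]
    nlinarith [mul_le_mul_of_nonneg_left ht5 hE0.le]
  have hE32 : 0 ≤ E ^ (3 / 2 : ℝ) := Real.rpow_nonneg hE0.le _
  have hρE : 0 ≤ ρ₀ ^ E := Real.rpow_nonneg hρ₀.1.le _
  have hL0 : 0 ≤ E * Real.log (1 / ρ₀) / (E * Real.log (1 / ρ₀) - 3 / 2) := div_nonneg (by nlinarith) (by linarith)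
  calc ∑' i : ↥({i : D.ι | E ≤ D.Δ i} : Set D.ι), D.p i * globalBlock (D.Δ i) (D.spin i) (1 / 2) (1 / 2)
      ≤ 8 * Real.exp 1 ^ 2 / (1 - ρ₀) ^ 4 * B * E ^ (3 / 2 : ℝ) * ρ₀ ^ E *
          (E * Real.log (1 / ρ₀) / (E * Real.log (1 / ρ₀) - 3 / 2)) := h
    _ ≤ 8 * Real.exp 1 ^ 2 * ((10000 : ℝ) / 8284) ^ 4 * B * E ^ (3 / 2 : ℝ) * ((1716 : ℝ) / 10000) ^ E *
          (E * Real.log 5 / (E * Real.log 5 - 3 / 2)) := by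
        have hA : 8 * Real.exp 1 ^ 2 / (1 - ρ₀) ^ 4 * B * E ^ (3 / 2 : ℝ) ≤
            8 * Real.exp 1 ^ 2 * ((10000 : ℝ) / 8284) ^ 4 * B * E ^ (3 / 2 : ℝ) :=
          mul_le_mul_of_nonneg_right (mul_le_mul_of_nonneg_right h1 hB0) hE32
        have hA0 : 0 ≤ 8 * Real.exp 1 ^ 2 * ((10000 : ℝ) / 8284) ^ 4 * B * E ^ (3 / 2 : ℝ) := by positivity
        exact mul_le_mul (mul_le_mul hA h2 hρE hA0) h3 hL0 (mul_nonneg hA0 (Real.rpow_nonneg (by norm_num) _))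

end Summit.CriticalPhenomena.Ising3D.Control2D
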